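import Literature.Analysis.FluidPDE.SteadyNavierStokesLimit
import HarnessLib

/-!
# Steady Navier–Stokes on `T^d`: the weak formulation and the energy inequality of the limit

Trunk: FluidKinetic (`Literature/Analysis/FluidPDE`). Fourth step of the existence proof of steady
weak solutions of the forced Navier–Stokes equations on the flat torus by the Galerkin method
(Temam, *Navier–Stokes Equations* (1977/79), Ch. II, §1, Thm. 1.2, proof, part (iii): passage
to the limit in `ν((u_m, v)) + b(u_m, u_m, v) = ⟨f, v⟩`, first for `v` in the Galerkin spaces and
then for all test fields by density/continuity; Robinson–Rodrigo–Sadowski 2016, Thm. 4.4,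
Step 4, for the Fourier truncations `P_N w → w` in `C¹` used on the torus).

* `steady_weak_form_of_galerkin_limit` — if smooth fields `U n`, bounded in `L²`, solve the
  tested Galerkin equations on the punctured balls `S_{N n}` (`N n → ∞`) and converge to `u`
  strongly in `L²`, then `∫ (⟪u, (u·∇)w⟫ + ν ⟪u, Δw⟫ + ⟪f, w⟫) = 0` for every smooth
  divergence-free mean-zero `w` (test the `n`-th equations with `P_{N n} w`, whose error against
  `w` is uniformly small together with first and second derivatives,
  `Torus.norm_sub_fourierTruncate_apply_le`, and pass to the limit in `n` with the slice estimate
  `Torus.enorm_sliceFunctional_sub_le`).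
* `tendsto_integral_inner_of_tendsto_lintegral_sub_sq` — pairings with a fixed `L²` field pass to
  strong `L²` limits.
* `steady_energy_le_of_galerkin_limit` — **the energy inequality of the limit**
  `ν ‖∇u‖² ≤ ∫ ⟪f, u⟫` (Fatou `‖∇u‖² ≤ liminf ‖∇U n‖²` and the Galerkin energy equations
  `ν ‖∇U n‖² = ∫ ⟪f, U n⟫ → ∫ ⟪f, u⟫`; Temam 1979, Ch. II, (1.31)–(1.32): lower semicontinuity
  of the norm under weak convergence).

## Mathlib / tree search

Tree: `Torus.enorm_sliceFunctional_sub_le`, `abs_weakIntegrand_trunc_le`,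
`Torus.convect_sub_apply`, `Torus.partialDeriv_sub_apply` (`NSHopfGalerkinLimit`),
`Torus.enorm_integral_inner_le_add`, `Torus.integrable_inner_of_memLp`,
`ENNReal.tendsto_zero_of_forall_le_ofReal_mul_add`, `Torus.lintegral_enorm_sq_eq_ofReal`
(`NSHopfEnergy`), `norm_sub_fourierTruncate_apply_le`, `tsum_compl_norm_mFourierCoeff_le`,
`exists_iterate_bound`, `tendsto_tsum_compl_freqBall_inv_pow`, `partialDeriv_fourierTruncate`,
`laplacian_fourierTruncate` (`TorusFourierSeries`), `isDivFree_fourierTruncate`,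
`mFourierCoeff_fourierTruncate` (`TorusTrigPoly`), `eGradNormSq_le_liminf_of_tendsto_mFourierCoeff`
(`NSHopfLimit`).

## References

* R. Temam, *Navier–Stokes Equations. Theory and Numerical Analysis*, North-Holland (1977;
  rev. ed. 1979), Ch. II, §1, Thm. 1.2 (proof, part (iii), (1.31)–(1.32)). [Temam1979]
* J. C. Robinson, J. L. Rodrigo, W. Sadowski, *The three-dimensional Navier–Stokes equations*,
  CUP (2016), Thm. 4.4, Step 4. [RobinsonRodrigoSadowski2016]
-/

open MeasureTheory Set Filter UnitAddTorus
open scoped ENNReal NNReal InnerProductSpace Topology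

noncomputable section

namespace Literature.Analysis.FluidPDE

section NS

open FunctionSpaces FunctionSpaces.Torus Torus

variable {d : Type*} [Fintype d] [DecidableEq d]

/-! ### Test fields: mean mode and uniform truncation errors -/

omit [DecidableEq d] in
/-- The zero Fourier mode of a mean-zero field vanishes: `𝓕(complexify ∘ w)(0) = complexify (∫ w) = 0`.
[folklore] -/
private theorem mFourierCoeff_complexify_zero_of_hasZeroMean' {w : UnitAddTorus d → EuclideanSpace ℝ d}
    (hmean : HasZeroMean w) : mFourierCoeff (EuclideanSpace.complexify ∘ w) 0 = 0 := by
  rw [mFourierCoeff_eq_integral_volume]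
  simp only [neg_zero, mFourier_zero, ContinuousMap.one_apply, one_smul, Function.comp_apply]
  rw [EuclideanSpace.complexify.integral_comp_comm w, hmean, map_zero]

/-- **The truncation error of a smooth field vanishes uniformly**: the majorant
`∑_{k ∉ ball N} ‖â(k)‖` of `‖a - P_N a‖_∞` tends to `0` (`tsum_compl_norm_mFourierCoeff_le` and the
lattice tails `tendsto_tsum_compl_freqBall_inv_pow`; Grafakos 2014, §3.3). [folklore] -/
theorem tendsto_tsum_compl_norm_mFourierCoeff {a : UnitAddTorus d → EuclideanSpace ℝ d}
    (ha : IsSmooth a) :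
    Tendsto (fun N : ℕ => ∑' k : {k // k ∉ freqBall (d := d) N},
      ‖mFourierCoeff (EuclideanSpace.complexify ∘ a) k‖) atTop (𝓝 0) := by
  obtain ⟨K, hK0, hK⟩ := exists_iterate_bound ha (Fintype.card d)
  refine squeeze_zero (fun N => tsum_nonneg fun _ => norm_nonneg _)
    (fun N => tsum_compl_norm_mFourierCoeff_le ha hK N) ?_
  simpa using tendsto_tsum_compl_freqBall_inv_pow.const_mul K

/-! ### Pairings pass to strong `L²` limits -/

omit [DecidableEq d] in
/-- **Pairings with a fixed `L²` field pass to strong `L²` limits**: if `∫ ‖U n - u‖² → 0` then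
`∫ ⟪f, U n⟫ → ∫ ⟪f, u⟫` for `f ∈ L²` (Young's inequality with a free parameter). [folklore] -/
theorem tendsto_integral_inner_of_tendsto_lintegral_sub_sq {U : ℕ → UnitAddTorus d → EuclideanSpace ℝ d}
    {u f : UnitAddTorus d → EuclideanSpace ℝ d} (hU : ∀ n, MemLp (U n) 2 volume)
    (hu : MemLp u 2 volume) (hf : MemLp f 2 volume)
    (hconv : Tendsto (fun n => ∫⁻ x, ‖U n x - u x‖ₑ ^ 2) atTop (𝓝 0)) :
    Tendsto (fun n => ∫ x, ⟪f x, U n x⟫_ℝ) atTop (𝓝 (∫ x, ⟪f x, u x⟫_ℝ)) := by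
  rw [tendsto_iff_edist_tendsto_0]
  have hfin : ∫⁻ x, ‖f x‖ₑ ^ 2 ≠ ⊤ := by
    rw [Torus.lintegral_enorm_sq_eq_ofReal hf]
    exact ENNReal.ofReal_ne_top
  refine ENNReal.tendsto_zero_of_forall_le_ofReal_mul_add hfin
    (X := fun lam n => ENNReal.ofReal (2 * (2 * lam))⁻¹ * ∫⁻ x, ‖U n x - u x‖ₑ ^ 2)
    (fun lam hlam => by
      simpa using ENNReal.Tendsto.const_mul hconv (a := ENNReal.ofReal (2 * (2 * lam))⁻¹)
        (Or.inr ENNReal.ofReal_ne_top))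
    (fun lam hlam => Eventually.of_forall fun n => ?_)
  rw [edist_eq_enorm_sub, ← integral_sub (Torus.integrable_inner_of_memLp hf (hU n))
    (Torus.integrable_inner_of_memLp hf hu)]
  have heq : (fun x => ⟪f x, U n x⟫_ℝ - ⟪f x, u x⟫_ℝ) = fun x => ⟪U n x - u x, f x⟫_ℝ := by
    funext x
    rw [← inner_sub_right, real_inner_comm]
  rw [heq]
  have h := Torus.enorm_integral_inner_le_add ((hU n).1.sub hu.1) hf.1 (η := 2 * lam) (by positivity)
  rw [show 2 * lam / 2 = lam by ring] at h
  calc ‖∫ x, ⟪U n x - u x, f x⟫_ℝ‖ₑ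
      ≤ ENNReal.ofReal (2 * (2 * lam))⁻¹ * (∫⁻ x, ‖U n x - u x‖ₑ ^ 2) +
          ENNReal.ofReal lam * ∫⁻ x, ‖f x‖ₑ ^ 2 := h
    _ = ENNReal.ofReal lam * (∫⁻ x, ‖f x‖ₑ ^ 2) +
          ENNReal.ofReal (2 * (2 * lam))⁻¹ * ∫⁻ x, ‖U n x - u x‖ₑ ^ 2 := add_comm _ _

/-! ### The weak formulation of the limit -/

/-- Integrability of the steady weak-form integrand `⟪U, (U·∇)b⟫ + ν ⟪U, Δb⟫ + ⟪f, b⟫` for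
`U, f ∈ L²` and smooth `b` (`|⟪U, (U·∇)b⟫| ≤ C ‖U‖²`). [folklore] -/
theorem integrable_steadyIntegrand {U f b : UnitAddTorus d → EuclideanSpace ℝ d}
    (hU : MemLp U 2 volume) (hf : MemLp f 2 volume) (hb : IsSmooth b) (ν : ℝ) :
    Integrable (fun x => ⟪U x, FunctionSpaces.Torus.convect U b x⟫_ℝ +
      ν * ⟪U x, FunctionSpaces.Torus.laplacian b x⟫_ℝ + ⟪f x, b x⟫_ℝ) volume := by
  have h := Torus.integrable_weakIntegrand hU hf hb (p := fun _ => 0) continuous_const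
    hb.laplacian.continuous ν
  simpa only [inner_zero_right, zero_add] using h

/-- **Step 1 of the passage to the limit: the steady weak-form functional is continuous along
strong `L²` limits** — `∫ (⟪U n, (U n·∇)w⟫ + ν ⟪U n, Δw⟫ + ⟪f, w⟫) → ∫ (⟪u, (u·∇)w⟫ + ν ⟪u, Δw⟫ + ⟪f, w⟫)`
when `∫ ‖U n - u‖² → 0` and `∫ ‖U n‖² ≤ Y` (the slice estimate `Torus.enorm_sliceFunctional_sub_le`
with a free parameter; Robinson–Rodrigo–Sadowski 2016, Thm. 4.4 Step 4). [folklore] -/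
theorem tendsto_steadyFunctional {ν : ℝ} {f : UnitAddTorus d → EuclideanSpace ℝ d}
    (hf : MemLp f 2 volume) {U : ℕ → UnitAddTorus d → EuclideanSpace ℝ d}
    {u : UnitAddTorus d → EuclideanSpace ℝ d} (hUmem : ∀ n, MemLp (U n) 2 volume) {Y : ℝ}
    (hUY : ∀ n, ∫ x, ‖U n x‖ ^ 2 ≤ Y) (hu : MemLp u 2 volume)
    (hconv : Tendsto (fun n => ∫⁻ x, ‖U n x - u x‖ₑ ^ 2) atTop (𝓝 0))
    {w : UnitAddTorus d → EuclideanSpace ℝ d} (hw : IsSmooth w) :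
    Tendsto (fun n => ∫ x, (⟪U n x, FunctionSpaces.Torus.convect (U n) w x⟫_ℝ +
      ν * ⟪U n x, FunctionSpaces.Torus.laplacian w x⟫_ℝ + ⟪f x, w x⟫_ℝ)) atTop
      (𝓝 (∫ x, (⟪u x, FunctionSpaces.Torus.convect u w x⟫_ℝ +
        ν * ⟪u x, FunctionSpaces.Torus.laplacian w x⟫_ℝ + ⟪f x, w x⟫_ℝ))) := by
  -- sup bounds for the test field
  obtain ⟨C, hC⟩ := isCompact_univ.exists_bound_of_continuousOn
    (continuous_finsetSum Finset.univ fun i _ => (hw.partialDeriv i).continuous.norm).continuousOn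
  have hC' : ∀ x, ∑ i, ‖FunctionSpaces.Torus.partialDeriv i w x‖ ≤ C := fun x => by
    have h := hC x (mem_univ x)
    rwa [Real.norm_eq_abs, abs_of_nonneg (Finset.sum_nonneg fun i _ => norm_nonneg _)] at h
  obtain ⟨KL, hKL⟩ := isCompact_univ.exists_bound_of_continuousOn hw.laplacian.continuous.continuousOn
  obtain ⟨Kq, hKq⟩ := isCompact_univ.exists_bound_of_continuousOn hw.continuous.continuousOn
  have hBu : ∫⁻ x, ‖u x‖ₑ ^ 2 ≠ ⊤ := by
    rw [Torus.lintegral_enorm_sq_eq_ofReal hu]; exact ENNReal.ofReal_ne_top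
  have hBU : ∀ n, ∫⁻ x, ‖U n x‖ₑ ^ 2 ≤ ENNReal.ofReal Y := fun n => by
    rw [Torus.lintegral_enorm_sq_eq_ofReal (hUmem n)]; exact ENNReal.ofReal_le_ofReal (hUY n)
  rw [tendsto_iff_edist_tendsto_0]
  refine ENNReal.tendsto_zero_of_forall_le_ofReal_mul_add
    (C := ENNReal.ofReal (ν ^ 2 * KL ^ 2 + Kq ^ 2) +
      ENNReal.ofReal (C ^ 2) * (ENNReal.ofReal Y + ∫⁻ x, ‖u x‖ₑ ^ 2)) ?_
    (X := fun lam n => ENNReal.ofReal (2 * (2 * lam))⁻¹ * (4 * ∫⁻ x, ‖U n x - u x‖ₑ ^ 2))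
    (fun lam hlam => ?_) (fun lam hlam => Eventually.of_forall fun n => ?_)
  · exact ENNReal.add_ne_top.2 ⟨ENNReal.ofReal_ne_top, ENNReal.mul_ne_top ENNReal.ofReal_ne_top
      (ENNReal.add_ne_top.2 ⟨ENNReal.ofReal_ne_top, hBu⟩)⟩
  · have h4 : Tendsto (fun n => (4 : ℝ≥0∞) * ∫⁻ x, ‖U n x - u x‖ₑ ^ 2) atTop (𝓝 ((4 : ℝ≥0∞) * 0)) :=
      ENNReal.Tendsto.const_mul hconv (Or.inr (by norm_num))
    have h := ENNReal.Tendsto.const_mul h4 (a := ENNReal.ofReal (2 * (2 * lam))⁻¹)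
      (Or.inr ENNReal.ofReal_ne_top)
    simpa using h
  · have h := Torus.enorm_sliceFunctional_sub_le (hUmem n) hu hf hf hw (p := fun _ => 0)
      (L := FunctionSpaces.Torus.laplacian w) continuous_const hw.laplacian.continuous hC'
      (Kp := 0) (fun x => by simp) (fun x => hKL x (mem_univ x)) (fun x => hKq x (mem_univ x)) ν
      (lam := 2 * lam) (by positivity)
    simp only [inner_zero_right, zero_add, sub_self, enorm_zero,
      zero_pow two_ne_zero, lintegral_zero, add_zero] at h
    rw [show 2 * lam / 2 = lam by ring] at h
    rw [edist_eq_enorm_sub]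
    have hBUn := hBU n
    have hmono : ENNReal.ofReal lam * (ENNReal.ofReal (ν ^ 2 * KL ^ 2 + Kq ^ 2) +
        ENNReal.ofReal (C ^ 2) * ((∫⁻ x, ‖U n x‖ₑ ^ 2) + ∫⁻ x, ‖u x‖ₑ ^ 2)) ≤
        ENNReal.ofReal lam * (ENNReal.ofReal (ν ^ 2 * KL ^ 2 + Kq ^ 2) +
        ENNReal.ofReal (C ^ 2) * (ENNReal.ofReal Y + ∫⁻ x, ‖u x‖ₑ ^ 2)) := by
      gcongr
    exact h.trans ((add_le_add le_rfl hmono).trans_eq (add_comm _ _))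

/-- **Step 2 of the passage to the limit: the truncation error of the steady functional.** For
smooth `U`, `w`, a force `f ∈ L²` and an order `M`, testing with `P_M w` instead of `w` changes
`∫ (⟪U, (U·∇)·⟫ + ν ⟪U, Δ·⟫ + ⟪f, ·⟫)` by at most
`(|ν| e₂/2 + e₃) ∫ ‖U‖² + (e₀/2) ∫ ‖f‖² + (|ν| e₂/2 + e₀/2)`, where `e₀, e₂, e₃` are the uniform
truncation-error majorants `∑_{k ∉ ball M} ‖·̂(k)‖` of `w`, `Δw` and of the `∂ᵢ w` (summed over `i`)
(`norm_sub_fourierTruncate_apply_le`; Robinson–Rodrigo–Sadowski 2016, Thm. 4.4 Step 4). [folklore] -/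
theorem norm_steadyFunctional_trunc_sub_le (ν : ℝ) {U f w : UnitAddTorus d → EuclideanSpace ℝ d}
    (hU : IsSmooth U) (hf : MemLp f 2 volume) (hw : IsSmooth w) (M : ℕ) :
    ‖(∫ x, (⟪U x, FunctionSpaces.Torus.convect U w x⟫_ℝ +
        ν * ⟪U x, FunctionSpaces.Torus.laplacian w x⟫_ℝ + ⟪f x, w x⟫_ℝ)) -
      ∫ x, (⟪U x, FunctionSpaces.Torus.convect U (fourierTruncate M w) x⟫_ℝ +
        ν * ⟪U x, FunctionSpaces.Torus.laplacian (fourierTruncate M w) x⟫_ℝ +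
        ⟪f x, fourierTruncate M w x⟫_ℝ)‖ ≤
      (|ν| * (∑' k : {k // k ∉ freqBall (d := d) M},
          ‖mFourierCoeff (EuclideanSpace.complexify ∘ FunctionSpaces.Torus.laplacian w) k‖) / 2 +
        ∑ i, ∑' k : {k // k ∉ freqBall (d := d) M},
          ‖mFourierCoeff (EuclideanSpace.complexify ∘ FunctionSpaces.Torus.partialDeriv i w) k‖) *
        (∫ x, ‖U x‖ ^ 2) +
      (∑' k : {k // k ∉ freqBall (d := d) M}, ‖mFourierCoeff (EuclideanSpace.complexify ∘ w) k‖) / 2 *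
        (∫ x, ‖f x‖ ^ 2) +
      (|ν| * (∑' k : {k // k ∉ freqBall (d := d) M},
          ‖mFourierCoeff (EuclideanSpace.complexify ∘ FunctionSpaces.Torus.laplacian w) k‖) / 2 +
        (∑' k : {k // k ∉ freqBall (d := d) M}, ‖mFourierCoeff (EuclideanSpace.complexify ∘ w) k‖) / 2) := by
  -- names for the error majorants
  obtain ⟨e₀, he₀⟩ : ∃ e : ℝ, e = ∑' k : {k // k ∉ freqBall (d := d) M},
    ‖mFourierCoeff (EuclideanSpace.complexify ∘ w) k‖ := ⟨_, rfl⟩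
  obtain ⟨e₂, he₂⟩ : ∃ e : ℝ, e = ∑' k : {k // k ∉ freqBall (d := d) M},
    ‖mFourierCoeff (EuclideanSpace.complexify ∘ FunctionSpaces.Torus.laplacian w) k‖ := ⟨_, rfl⟩
  obtain ⟨e₃, he₃⟩ : ∃ e : ℝ, e = ∑ i, ∑' k : {k // k ∉ freqBall (d := d) M},
    ‖mFourierCoeff (EuclideanSpace.complexify ∘ FunctionSpaces.Torus.partialDeriv i w) k‖ := ⟨_, rfl⟩
  rw [← he₀, ← he₂, ← he₃]
  have he₀0 : 0 ≤ e₀ := by rw [he₀]; exact tsum_nonneg fun _ => norm_nonneg _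
  have he₂0 : 0 ≤ e₂ := by rw [he₂]; exact tsum_nonneg fun _ => norm_nonneg _
  have he₃0 : 0 ≤ e₃ := by
    rw [he₃]; exact Finset.sum_nonneg fun i _ => tsum_nonneg fun _ => norm_nonneg _
  have hUm : MemLp U 2 volume := hU.continuous.memLp_of_hasCompactSupport (HasCompactSupport.of_compactSpace _)
  have hPs : IsSmooth (fourierTruncate M w) := isSmooth_fourierTruncate _ _
  have i1 := integrable_steadyIntegrand hUm hf hw ν
  have i2 := integrable_steadyIntegrand hUm hf hPs ν
  rw [← integral_sub i1 i2]
  -- pointwise bound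
  have h₀ : ∀ x, ‖w x - fourierTruncate M w x‖ ≤ e₀ := fun x => by
    rw [he₀]; exact norm_sub_fourierTruncate_apply_le hw M x
  have h₂ : ∀ x, ‖FunctionSpaces.Torus.laplacian w x - fourierTruncate M (FunctionSpaces.Torus.laplacian w) x‖ ≤ e₂ :=
    fun x => by rw [he₂]; exact norm_sub_fourierTruncate_apply_le hw.laplacian M x
  have h₃ : ∀ x, ∑ i, ‖FunctionSpaces.Torus.partialDeriv i (fun y => w y - fourierTruncate M w y) x‖ ≤ e₃ := by
    intro x
    rw [he₃]
    refine Finset.sum_le_sum fun i _ => ?_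
    rw [Torus.partialDeriv_sub_apply hw hPs, partialDeriv_fourierTruncate hw]
    exact norm_sub_fourierTruncate_apply_le (hw.partialDeriv i) M x
  have hpt : ∀ x, ‖(⟪U x, FunctionSpaces.Torus.convect U w x⟫_ℝ +
      ν * ⟪U x, FunctionSpaces.Torus.laplacian w x⟫_ℝ + ⟪f x, w x⟫_ℝ) -
      (⟪U x, FunctionSpaces.Torus.convect U (fourierTruncate M w) x⟫_ℝ +
      ν * ⟪U x, FunctionSpaces.Torus.laplacian (fourierTruncate M w) x⟫_ℝ +
      ⟪f x, fourierTruncate M w x⟫_ℝ)‖ ≤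
      (|ν| * e₂ / 2 + e₃) * ‖U x‖ ^ 2 + e₀ / 2 * ‖f x‖ ^ 2 + (|ν| * e₂ / 2 + e₀ / 2) := by
    intro x
    have hd : (⟪U x, FunctionSpaces.Torus.convect U w x⟫_ℝ +
        ν * ⟪U x, FunctionSpaces.Torus.laplacian w x⟫_ℝ + ⟪f x, w x⟫_ℝ) -
        (⟪U x, FunctionSpaces.Torus.convect U (fourierTruncate M w) x⟫_ℝ +
        ν * ⟪U x, FunctionSpaces.Torus.laplacian (fourierTruncate M w) x⟫_ℝ +
        ⟪f x, fourierTruncate M w x⟫_ℝ) =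
        ⟪U x, FunctionSpaces.Torus.convect U (fun y => w y - fourierTruncate M w y) x⟫_ℝ +
        ν * ⟪U x, FunctionSpaces.Torus.laplacian w x -
          fourierTruncate M (FunctionSpaces.Torus.laplacian w) x⟫_ℝ +
        ⟪f x, w x - fourierTruncate M w x⟫_ℝ := by
      rw [Torus.convect_sub_apply hw hPs, laplacian_fourierTruncate hw]
      simp only [inner_sub_right]
      ring
    rw [hd, Real.norm_eq_abs]
    have hdc : ‖FunctionSpaces.Torus.convect U (fun y => w y - fourierTruncate M w y) x‖ ≤ ‖U x‖ * e₃ :=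
      (norm_convect_le U ((hw.sub hPs).isContDiff (by simp)) x).trans
        (mul_le_mul_of_nonneg_left (h₃ x) (norm_nonneg _))
    have hkey := abs_weakIntegrand_trunc_le (U x) (f x) 0
      (FunctionSpaces.Torus.convect U (fun y => w y - fourierTruncate M w y) x)
      (FunctionSpaces.Torus.laplacian w x - fourierTruncate M (FunctionSpaces.Torus.laplacian w) x)
      (w x - fourierTruncate M w x) ν he₀0 le_rfl he₂0 (e₃ := e₃)
      (le_of_eq norm_zero) (h₂ x) (h₀ x) hdc
    rw [inner_zero_right, zero_add] at hkey
    refine hkey.trans (le_of_eq ?_)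
    ring
  -- integrate
  have iU : Integrable (fun x => ‖U x‖ ^ 2) volume := (hU.continuous.norm.pow 2).integrable_unitAddTorus
  have iF : Integrable (fun x => ‖f x‖ ^ 2) volume := hf.integrable_norm_pow two_ne_zero
  have i12 : Integrable (fun x => (|ν| * e₂ / 2 + e₃) * ‖U x‖ ^ 2 + e₀ / 2 * ‖f x‖ ^ 2) volume :=
    (iU.const_mul _).add (iF.const_mul _)
  have i123 : Integrable (fun x => (|ν| * e₂ / 2 + e₃) * ‖U x‖ ^ 2 + e₀ / 2 * ‖f x‖ ^ 2 +
      (|ν| * e₂ / 2 + e₀ / 2)) volume := i12.add (integrable_const _)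
  refine (norm_integral_le_of_norm_le i123 (ae_of_all _ hpt)).trans (le_of_eq ?_)
  rw [integral_add i12 (integrable_const _), integral_add (iU.const_mul _) (iF.const_mul _),
    integral_const_mul, integral_const_mul, integral_const]
  simp [Measure.real]

/-- **The limit satisfies the steady weak formulation** (Temam 1979, Ch. II, §1, proof of
Thm. 1.2, part (iii); Robinson–Rodrigo–Sadowski 2016, Thm. 4.4 Step 4 on the torus). Let
`f ∈ L²`, let `N n` be strictly increasing, and let smooth fields `U n` with `∫ ‖U n‖² ≤ Y`
satisfy the tested Galerkin equations `∫ (⟪U n, (U n·∇)a⟫ + ν ⟪U n, Δa⟫ + ⟪f, a⟫) = 0` for all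
smooth divergence-free `a` band-limited to the punctured ball `S_{N n}`. If `∫ ‖U n - u‖² → 0`
with `u ∈ L²`, then `∫ (⟪u, (u·∇)w⟫ + ν ⟪u, Δw⟫ + ⟪f, w⟫) = 0` for every smooth
divergence-free mean-zero `w`. Proof: `Φₙ(w) → Φ(w)` (`tendsto_steadyFunctional`), while
`Φₙ(w) = Φₙ(w) - Φₙ(P_{N n} w) → 0` (`norm_steadyFunctional_trunc_sub_le` and the vanishing of
the truncation errors, `tendsto_tsum_compl_norm_mFourierCoeff`).
[cite: Temam1979, Ch. II Thm. 1.2 (proof (iii))] -/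
theorem steady_weak_form_of_galerkin_limit {ν : ℝ} {f : UnitAddTorus d → EuclideanSpace ℝ d}
    (hf : MemLp f 2 volume) {N : ℕ → ℕ} (hN : StrictMono N)
    {U : ℕ → UnitAddTorus d → EuclideanSpace ℝ d} {u : UnitAddTorus d → EuclideanSpace ℝ d}
    (hUs : ∀ n, IsSmooth (U n)) {Y : ℝ} (hUY : ∀ n, ∫ x, ‖U n x‖ ^ 2 ≤ Y)
    (hgal : ∀ n (a : UnitAddTorus d → EuclideanSpace ℝ d), IsSmooth a → IsDivFree a →
      (∀ k ∉ (freqBall (d := d) (N n)).erase 0,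
        mFourierCoeff (EuclideanSpace.complexify ∘ a) k = 0) →
      ∫ x, (⟪U n x, FunctionSpaces.Torus.convect (U n) a x⟫_ℝ +
        ν * ⟪U n x, FunctionSpaces.Torus.laplacian a x⟫_ℝ + ⟪f x, a x⟫_ℝ) = 0)
    (hu : MemLp u 2 volume) (hconv : Tendsto (fun n => ∫⁻ x, ‖U n x - u x‖ₑ ^ 2) atTop (𝓝 0))
    {w : UnitAddTorus d → EuclideanSpace ℝ d} (hw : IsSmooth w) (hwdiv : IsDivFree w)
    (hwmean : HasZeroMean w) :
    ∫ x, (⟪u x, FunctionSpaces.Torus.convect u w x⟫_ℝ +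
      ν * ⟪u x, FunctionSpaces.Torus.laplacian w x⟫_ℝ + ⟪f x, w x⟫_ℝ) = 0 := by
  have hUmem : ∀ n, MemLp (U n) 2 volume := fun n =>
    (hUs n).continuous.memLp_of_hasCompactSupport (HasCompactSupport.of_compactSpace _)
  have hwi : Integrable w volume := hw.continuous.integrable_unitAddTorus
  have hY0 : 0 ≤ Y := (integral_nonneg fun x => sq_nonneg _).trans (hUY 0)
  -- Step 1
  have h1 := tendsto_steadyFunctional (ν := ν) hf hUmem hUY hu hconv hw
  -- Step 2: the Galerkin equations tested with `P_{N n} w` and the truncation error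
  have hΨ : ∀ n, ∫ x, (⟪U n x, FunctionSpaces.Torus.convect (U n) (fourierTruncate (N n) w) x⟫_ℝ +
      ν * ⟪U n x, FunctionSpaces.Torus.laplacian (fourierTruncate (N n) w) x⟫_ℝ +
      ⟪f x, fourierTruncate (N n) w x⟫_ℝ) = 0 := by
    intro n
    refine hgal n _ (isSmooth_fourierTruncate _ _) (isDivFree_fourierTruncate
      (hw.continuous.memLp_of_hasCompactSupport (HasCompactSupport.of_compactSpace _))
      (hwdiv.isWeaklyDivFree_holds hw) _) fun k hk => ?_
    rw [mFourierCoeff_fourierTruncate hwi]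
    by_cases hkb : k ∈ freqBall (d := d) (N n)
    · have hk0 : k = 0 := by
        by_contra h
        exact hk (Finset.mem_erase.2 ⟨h, hkb⟩)
      rw [if_pos hkb, hk0, mFourierCoeff_complexify_zero_of_hasZeroMean' hwmean]
    · rw [if_neg hkb]
  -- the error majorants (opaque names) and their vanishing along `N n`
  obtain ⟨e₀, he₀⟩ : ∃ e : ℕ → ℝ, ∀ M, e M = ∑' k : {k // k ∉ freqBall (d := d) M},
      ‖mFourierCoeff (EuclideanSpace.complexify ∘ w) k‖ := ⟨_, fun _ => rfl⟩
  obtain ⟨e₂, he₂⟩ : ∃ e : ℕ → ℝ, ∀ M, e M = ∑' k : {k // k ∉ freqBall (d := d) M},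
      ‖mFourierCoeff (EuclideanSpace.complexify ∘ FunctionSpaces.Torus.laplacian w) k‖ :=
    ⟨_, fun _ => rfl⟩
  obtain ⟨e₃, he₃⟩ : ∃ e : ℕ → ℝ, ∀ M, e M = ∑ i, ∑' k : {k // k ∉ freqBall (d := d) M},
      ‖mFourierCoeff (EuclideanSpace.complexify ∘ FunctionSpaces.Torus.partialDeriv i w) k‖ :=
    ⟨_, fun _ => rfl⟩
  have he₂0 : ∀ M, 0 ≤ e₂ M := fun M => by rw [he₂]; exact tsum_nonneg fun _ => norm_nonneg _
  have he₃0 : ∀ M, 0 ≤ e₃ M := fun M => by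
    rw [he₃]; exact Finset.sum_nonneg fun i _ => tsum_nonneg fun _ => norm_nonneg _
  have hfe₀ : e₀ = fun M => ∑' k : {k // k ∉ freqBall (d := d) M},
      ‖mFourierCoeff (EuclideanSpace.complexify ∘ w) k‖ := funext he₀
  have hfe₂ : e₂ = fun M => ∑' k : {k // k ∉ freqBall (d := d) M},
      ‖mFourierCoeff (EuclideanSpace.complexify ∘ FunctionSpaces.Torus.laplacian w) k‖ := funext he₂
  have hfe₃ : e₃ = fun M => ∑ i, ∑' k : {k // k ∉ freqBall (d := d) M},
      ‖mFourierCoeff (EuclideanSpace.complexify ∘ FunctionSpaces.Torus.partialDeriv i w) k‖ :=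
    funext he₃
  have hl₀ : Tendsto (fun n => e₀ (N n)) atTop (𝓝 0) := by
    rw [hfe₀]; exact (tendsto_tsum_compl_norm_mFourierCoeff hw).comp hN.tendsto_atTop
  have hl₂ : Tendsto (fun n => e₂ (N n)) atTop (𝓝 0) := by
    rw [hfe₂]; exact (tendsto_tsum_compl_norm_mFourierCoeff hw.laplacian).comp hN.tendsto_atTop
  have hl₃ : Tendsto (fun n => e₃ (N n)) atTop (𝓝 0) := by
    have h : Tendsto e₃ atTop (𝓝 (∑ i : d, (0 : ℝ))) := by
      rw [hfe₃]
      exact tendsto_finsetSum _ fun i _ => tendsto_tsum_compl_norm_mFourierCoeff (hw.partialDeriv i)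
    rw [Finset.sum_const_zero] at h
    exact h.comp hN.tendsto_atTop
  have hbound : ∀ n, ‖∫ x, (⟪U n x, FunctionSpaces.Torus.convect (U n) w x⟫_ℝ +
      ν * ⟪U n x, FunctionSpaces.Torus.laplacian w x⟫_ℝ + ⟪f x, w x⟫_ℝ)‖ ≤
      (|ν| * e₂ (N n) / 2 + e₃ (N n)) * Y + e₀ (N n) / 2 * (∫ x, ‖f x‖ ^ 2) +
        (|ν| * e₂ (N n) / 2 + e₀ (N n) / 2) := by
    intro n
    have h := norm_steadyFunctional_trunc_sub_le ν (hUs n) hf hw (N n)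
    simp only [hΨ n, sub_zero] at h
    rw [← he₀ (N n), ← he₂ (N n), ← he₃ (N n)] at h
    refine h.trans ?_
    have hc0 : 0 ≤ |ν| * e₂ (N n) / 2 + e₃ (N n) :=
      add_nonneg (div_nonneg (mul_nonneg (abs_nonneg ν) (he₂0 _)) zero_le_two) (he₃0 _)
    have hmul := mul_le_mul_of_nonneg_left (hUY n) hc0
    exact add_le_add (add_le_add hmul le_rfl) le_rfl
  have h2 : Tendsto (fun n => ∫ x, (⟪U n x, FunctionSpaces.Torus.convect (U n) w x⟫_ℝ +
      ν * ⟪U n x, FunctionSpaces.Torus.laplacian w x⟫_ℝ + ⟪f x, w x⟫_ℝ)) atTop (𝓝 0) := by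
    refine squeeze_zero_norm hbound ?_
    have h := ((((hl₂.const_mul |ν|).div_const 2).add hl₃).mul_const Y).add
      ((hl₀.div_const 2).mul_const (∫ x, ‖f x‖ ^ 2)) |>.add
      (((hl₂.const_mul |ν|).div_const 2).add (hl₀.div_const 2))
    simpa using h
  exact tendsto_nhds_unique h1 h2

/-! ### The energy inequality of the limit -/

omit [DecidableEq d] in
/-- **The energy inequality of the limit** (Temam 1979, Ch. II, §1, proof of Thm. 1.2,
(1.31)–(1.32): lower semicontinuity under weak convergence; here Fatou on the Fourier side).
If `ν > 0`, `Û n → û` coefficientwise, `∫ ‖U n - u‖² → 0`, and the Galerkin energy equations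
`ν ‖∇U n‖² = ∫ ⟪f, U n⟫` hold with `‖∇U n‖² < ∞`, then `‖∇u‖² < ∞` and
`ν ‖∇u‖² ≤ ∫ ⟪f, u⟫`. [cite: Temam1979, Ch. II Thm. 1.2 (proof, (1.31)–(1.32))] -/
theorem steady_energy_le_of_galerkin_limit {ν : ℝ} (hν : 0 < ν)
    {f : UnitAddTorus d → EuclideanSpace ℝ d} (hf : MemLp f 2 volume)
    {U : ℕ → UnitAddTorus d → EuclideanSpace ℝ d} {u : UnitAddTorus d → EuclideanSpace ℝ d}
    (hUmem : ∀ n, MemLp (U n) 2 volume) (hu : MemLp u 2 volume)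
    (hfin : ∀ n, eGradNormSq (U n) ≠ ⊤)
    (hen : ∀ n, ν * (eGradNormSq (U n)).toReal = ∫ x, ⟪f x, U n x⟫_ℝ)
    (hc : ∀ k, Tendsto (fun n => mFourierCoeff (EuclideanSpace.complexify ∘ U n) k) atTop
      (𝓝 (mFourierCoeff (EuclideanSpace.complexify ∘ u) k)))
    (hconv : Tendsto (fun n => ∫⁻ x, ‖U n x - u x‖ₑ ^ 2) atTop (𝓝 0)) :
    eGradNormSq u ≠ ⊤ ∧ ν * (eGradNormSq u).toReal ≤ ∫ x, ⟪f x, u x⟫_ℝ := by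
  set P : ℝ := ∫ x, ⟪f x, u x⟫_ℝ with hPdef
  have hpair : Tendsto (fun n => ∫ x, ⟪f x, U n x⟫_ℝ) atTop (𝓝 P) :=
    tendsto_integral_inner_of_tendsto_lintegral_sub_sq hUmem hu hf hconv
  -- `‖∇U n‖² → P/ν`
  have hE : Tendsto (fun n => (eGradNormSq (U n)).toReal) atTop (𝓝 (P / ν)) := by
    have h : (fun n => (eGradNormSq (U n)).toReal) = fun n => (∫ x, ⟪f x, U n x⟫_ℝ) / ν := by
      funext n
      rw [← hen n, mul_div_cancel_left₀ _ hν.ne']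
    rw [h]
    exact hpair.div_const ν
  have hP0 : 0 ≤ P / ν :=
    ge_of_tendsto' hE fun n => ENNReal.toReal_nonneg
  -- Fatou
  have hFatou : eGradNormSq u ≤ ENNReal.ofReal (P / ν) := by
    have h := eGradNormSq_le_liminf_of_tendsto_mFourierCoeff (U := fun n (_ : ℝ) => U n)
      (u := fun _ : ℝ => u) (fun _ _ k => hc k) (t := 0) le_rfl
    refine h.trans (le_of_eq ?_)
    have h2 : Tendsto (fun n => eGradNormSq (U n)) atTop (𝓝 (ENNReal.ofReal (P / ν))) := by
      have h3 := ENNReal.tendsto_ofReal hE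
      refine h3.congr fun n => ?_
      exact ENNReal.ofReal_toReal (hfin n)
    exact h2.liminf_eq
  have hfinu : eGradNormSq u ≠ ⊤ := ne_top_of_le_ne_top ENNReal.ofReal_ne_top hFatou
  refine ⟨hfinu, ?_⟩
  have h1 : (eGradNormSq u).toReal ≤ P / ν := by
    have := ENNReal.toReal_mono ENNReal.ofReal_ne_top hFatou
    rwa [ENNReal.toReal_ofReal hP0] at this
  calc ν * (eGradNormSq u).toReal ≤ ν * (P / ν) := mul_le_mul_of_nonneg_left h1 hν.le
    _ = P := mul_div_cancel₀ _ hν.ne'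

end NS

end Literature.Analysis.FluidPDE
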